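import Summits.AtomisticToContinuum.BoseEinsteinCondensation.Theorems.BECGroundStateSOSPeriodicIRBoundClassScaling
import Summits.AtomisticToContinuum.BoseEinsteinCondensation.Theorems.BECGroundStateSOSPeriodicIRBoundTowerTransfer
import Summits.AtomisticToContinuum.BoseEinsteinCondensation.Theorems.BECSectorPoincareTwoScaleLandauToPeriodicBECModeCounting
import HarnessLib

/-!
# Route `BECGroundStateSOS`, crux `PeriodicIRBound` (stmt-AtomisticToContinuum-3972), line
# `hardcore-monotone-class-uniformity` — the crux and its floor from `C⁺(1)` ALONE

Registered by-product stubs `stub_reductionToClassUniformOne` and `stub_floorOfClassUniformOne` of the line's skeleton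
(`Cruxes/PeriodicIRBound/Lines/hardcore_monotone_class_uniformity.lean`, v3-a1 §5). With the two lever stubs LANDED —
`stub_classScaling` (WLOG unit range for the class-uniform bound, `…PeriodicIRBoundClassScaling.lean`) and
`stub_towerTransfer` (the truncation transfer `min(v, M) ↑ v` at fixed `(N, L_N)`, `…PeriodicIRBoundTowerTransfer.lean`)
— the crux is ONE named statement away, `C⁺(1)`: the crux's infrared inequality `n_k(Ψ) ≤ C√ρL_N/‖k‖_∞` on the window
`0 < ‖k‖_∞ ≤ κ√ρL_N` for the `δ`-near-minimisers of every BOUNDED repulsive potential of range `≤ 1`, with data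
`(ρ₀, C)`, `N`-threshold and slack `δ_N` uniform over that class (the registered hardest stub `stub_classUniformIR`,
open; ≥ torus TL-BEC). This file records, as tree theorems in hypothesis form:

* `stub_reductionToClassUniformOne` — `C⁺(1) ⇒ ∀ v admissible, IRBoundFor v` (the crux unfolded; by name it is
  `Negative.periodicIRBound_iff.2 (stub_reductionToClassUniformOne h)`), for EVERY admissible `v` — hard cores and
  non-`L¹` spikes included: scale the class data to the range of `v`, feed every truncation `min(v, M)` (a bounded
  class member of the same range) to the class bound, transfer along the tower;
* `stub_floorOfClassUniformOne` — the FLOOR of the line's residual: `C⁺(1)` alone gives torus BEC of the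
  `δ`-near-minimisers at every small density, eventually in `N`, for every admissible potential (the reduction, then
  the landed per-potential mode counting `LandauToPeriodicBEC.periodicBEC_of_irBoundFor`). So the open stub carries at
  least the summit conjunct in its periodic form on the whole admissible class — the difficulty floor of
  `…PeriodicIRBoundDifficultyFloor.lean` needed the crux itself to reach the non-integrable potentials; here the
  bounded-class statement suffices.

No new definitions (statements over the landed vocabulary `NearMin / InWindow / IRIneq / IRBoundFor`, `truncPotential`).
References: LSSY2005 §1.2 (1.17)–(1.19) (BEC criterion), Ch. 2 (periodic box); Reed–Simon IV Thm XIII.64 (monotone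
convergence of forms, behind the landed transfer).
-/

noncomputable section

open MeasureTheory Filter
open scoped ENNReal NNReal

namespace Summit.AtomisticToContinuum.BoseEinsteinCondensation.Cruxes.PeriodicIRBound.HardcoreMonotoneClassUniformity

open Literature.MathematicalPhysics.QuantumManyBody.BoseGas
open Summit.AtomisticToContinuum.BoseEinsteinCondensation.Theorems.PeriodicIRBound.Negative
  (NearMin InWindow IRIneq IRBoundFor)
open Summit.AtomisticToContinuum.BoseEinsteinCondensation.Theorems.LandauToPeriodicBEC (periodicBEC_of_irBoundFor)

/-- Truncations of an admissible potential are admissible (measurable, same range). [folklore] -/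
private theorem isRepulsiveFiniteRange_truncPotential' {v : ℝ → ℝ≥0∞} (hv : IsRepulsiveFiniteRange v) (M : ℕ) :
    IsRepulsiveFiniteRange (truncPotential v M) := by
  refine ⟨measurable_truncPotential hv.1 M, ?_⟩
  obtain ⟨R₀, hR₀⟩ := hv.2
  exact ⟨R₀, fun r hr => by simp [truncPotential, hR₀ r hr]⟩

/-- **Class ⇒ tower**: the class-uniform bound at range `R₀` serves the whole truncation tower of every admissible `v`
of range `≤ R₀` (each `min(v, M)` is a bounded admissible class member of range `≤ R₀`), at every level. [folklore] -/
private theorem tower_of_class {R₀ : ℝ}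
    (h : ∀ κ : ℝ, 0 < κ → ∃ ρ₀ : ℝ, 0 < ρ₀ ∧ ∃ C : ℝ, 0 < C ∧ ∀ ρ : ℝ, 0 < ρ → ρ < ρ₀ →
      ∀ᶠ N : ℕ in atTop, ∃ δ : ℝ≥0∞, 0 < δ ∧
        ∀ w : ℝ → ℝ≥0∞, IsRepulsiveFiniteRange w → (∀ r, R₀ < r → w r = 0) →
          (∃ M : ℝ≥0∞, M ≠ ⊤ ∧ ∀ r, w r ≤ M) →
          ∀ Ψ : PeriodicTrialState N (sideLength ρ N), NearMin w ρ N δ Ψ →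
            ∀ k : Fin 3 → ℤ, InWindow κ ρ N k → IRIneq C ρ N Ψ.ψ k)
    {v : ℝ → ℝ≥0∞} (hv : IsRepulsiveFiniteRange v) (hvR : ∀ r, R₀ < r → v r = 0) :
    ∀ κ : ℝ, 0 < κ → ∃ ρ₀ : ℝ, 0 < ρ₀ ∧ ∃ C : ℝ, 0 < C ∧ ∀ ρ : ℝ, 0 < ρ → ρ < ρ₀ →
      ∀ᶠ N : ℕ in atTop, ∃ δ : ℝ≥0∞, 0 < δ ∧ ∀ M₁ : ℕ, ∃ M : ℕ, M₁ ≤ M ∧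
        ∀ Ψ : PeriodicTrialState N (sideLength ρ N), NearMin (truncPotential v M) ρ N δ Ψ →
          ∀ k : Fin 3 → ℤ, InWindow κ ρ N k → IRIneq C ρ N Ψ.ψ k := by
  intro κ hκ
  obtain ⟨ρ₀, hρ₀, C, hC, hW⟩ := h κ hκ
  refine ⟨ρ₀, hρ₀, C, hC, fun ρ hρ hρρ₀ => ?_⟩
  filter_upwards [hW ρ hρ hρρ₀] with N ⟨δ, hδ, hN⟩
  exact ⟨δ, hδ, fun M₁ => ⟨M₁, le_rfl, fun Ψ hΨ k hk =>
    hN (truncPotential v M₁) (isRepulsiveFiniteRange_truncPotential' hv M₁)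
      (fun r hr => by simp [truncPotential, hvR r hr])
      ⟨M₁, ENNReal.natCast_ne_top M₁, fun _ => min_le_right _ _⟩ Ψ hΨ k hk⟩⟩

/-- **The crux, per potential, from `C⁺(1)` alone** (registered by-product stub `stub_reductionToClassUniformOne`):
if ONE slack per `N` serves every bounded admissible potential of range `≤ 1` (the hypothesis is the registered
signature of the open stub `stub_classUniformIR`, verbatim), then `IRBoundFor v` holds for EVERY repulsive finite-range
`v` — hard cores and non-integrable spikes included; the crux by name is `periodicIRBound_iff.2` of this. Proof: range
`R` of `v` (`exists_pos_range`) → class data at range `R` (`stub_classScaling`) → the truncation tower of `v`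
(`tower_of_class`) → `stub_towerTransfer`. [folklore] -/
theorem stub_reductionToClassUniformOne :
    (∀ κ : ℝ, 0 < κ → ∃ ρ₀ : ℝ, 0 < ρ₀ ∧ ∃ C : ℝ, 0 < C ∧ ∀ ρ : ℝ, 0 < ρ → ρ < ρ₀ →
      ∀ᶠ N : ℕ in atTop, ∃ δ : ℝ≥0∞, 0 < δ ∧
        ∀ w : ℝ → ℝ≥0∞, IsRepulsiveFiniteRange w → (∀ r, 1 < r → w r = 0) →
          (∃ M : ℝ≥0∞, M ≠ ⊤ ∧ ∀ r, w r ≤ M) →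
          ∀ Ψ : PeriodicTrialState N (sideLength ρ N), NearMin w ρ N δ Ψ →
            ∀ k : Fin 3 → ℤ, InWindow κ ρ N k → IRIneq C ρ N Ψ.ψ k) →
    ∀ v : ℝ → ℝ≥0∞, IsRepulsiveFiniteRange v → IRBoundFor v := by
  intro h1 v hv
  obtain ⟨R, hR, hvR⟩ := hv.exists_pos_range
  exact stub_towerTransfer v hv (tower_of_class (stub_classScaling h1 R hR) hv hvR)

/-- **FLOOR of the line's residual** (registered by-product stub `stub_floorOfClassUniformOne`): `C⁺(1)` alone gives
torus BEC of the `δ`-near-minimisers (`n₀ ≥ cN`) at every small density, eventually in `N`, for EVERY admissible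
potential — the reduction above, then the landed per-potential mode counting `periodicBEC_of_irBoundFor` (Plancherel
sum rules + LSSY upper bound + UV Markov tail). So the open stub is at least the summit conjunct in its periodic form on
the whole admissible class. [cite: LSSY2005, §1.2 (1.17)–(1.19)] -/
theorem stub_floorOfClassUniformOne :
    (∀ κ : ℝ, 0 < κ → ∃ ρ₀ : ℝ, 0 < ρ₀ ∧ ∃ C : ℝ, 0 < C ∧ ∀ ρ : ℝ, 0 < ρ → ρ < ρ₀ →
      ∀ᶠ N : ℕ in atTop, ∃ δ : ℝ≥0∞, 0 < δ ∧
        ∀ w : ℝ → ℝ≥0∞, IsRepulsiveFiniteRange w → (∀ r, 1 < r → w r = 0) →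
          (∃ M : ℝ≥0∞, M ≠ ⊤ ∧ ∀ r, w r ≤ M) →
          ∀ Ψ : PeriodicTrialState N (sideLength ρ N), NearMin w ρ N δ Ψ →
            ∀ k : Fin 3 → ℤ, InWindow κ ρ N k → IRIneq C ρ N Ψ.ψ k) →
    ∀ v : ℝ → ℝ≥0∞, IsRepulsiveFiniteRange v →
      ∃ ρ₀ : ℝ, 0 < ρ₀ ∧ ∀ ρ : ℝ, 0 < ρ → ρ < ρ₀ → ∃ c : ℝ, 0 < c ∧ ∀ᶠ N : ℕ in atTop,
        ∃ δ : ℝ≥0∞, 0 < δ ∧ ∀ Ψ : PeriodicTrialState N (sideLength ρ N),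
          periodicEnergy v Ψ ≤ periodicGroundStateEnergy v N (sideLength ρ N) + δ →
            ENNReal.ofReal (c * N) ≤ condensateOccupation N (sideLength ρ N) Ψ.ψ :=
  fun h1 v hv => periodicBEC_of_irBoundFor v hv (stub_reductionToClassUniformOne h1 v hv)

end Summit.AtomisticToContinuum.BoseEinsteinCondensation.Cruxes.PeriodicIRBound.HardcoreMonotoneClassUniformity

end
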